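import Mathlib
import Summits.Ventures.PercRepro2.Defs
import Summits.Ventures.PercRepro2.Graph
import Summits.Ventures.PercRepro2.OneColourSwitch
import Summits.Ventures.PercRepro2.RegionHubSign
import Summits.Ventures.PercRepro2.SideSwitch
import Summits.Ventures.PercRepro2.SideSwitchFibre
import Summits.Ventures.PercRepro2.SideSwitchClosed
import Summits.Ventures.PercRepro2.SideSwitchComps
import Summits.Ventures.PercRepro2.M9NoPocketDefs

/-!
# The multi-`d` class without pockets — definitions (blind cell PercRepro2, p3 g20,
2026-08-27; `proofs/P3-CPNC.md` §17i (2))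

For a finite marked multigraph and a set `D` of non-marks, the `m9` sign sum restricted to the
`Sep`-colourings in which no vertex outside `{r, s} ∪ D` is doubly reached from `{r, s}`
(`DSub`, the member `D₀ = D` of the cumulative family of §16h) is studied through the
two-colour worlds of `{r, s}` in the graph `G − D`, realised on the same edge type by turning
every edge at `D` into a loop at `r` (`endsD`; a loop never carries an open adjacency, so its
location is immaterial).  This file has the looped graph and its transfer lemmas, and the
objects of the fibration: the `T`-edges `Tset` (between `D` and `{r, s}`), the coordinate
assignment `assignX`, the source predicates `srcY` / `srcW` of each `d ∈ D`, the legal vectors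
`L4`, the representatives `RepD`, the predicate `DSub` and the restricted sign sum `dSignSum`.
The single-`d` chain `M9NoPocket*` is the case `D = {d}`; `flipF` and the path-transfer lemma
`conn_of_le_off_touches` are reused from it.  Own work; std axioms.
-/

namespace Summit.Ventures.PercRepro2

namespace NoPocketSet

open Finset Classical RegionHub OneColourSwitch SideSwitch NoPocket

variable {V : Type*} {E : Type*}

section LoopedGraph

variable (ends : E → Sym2 V) (D : Finset V) (r : V)

/-- An edge at `D`: some vertex of `D` is an endpoint. -/
def AtD (e : E) : Prop := ∃ d ∈ D, d ∈ ends e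

/-- The graph `G − D` on the same edge type: every edge at `D` becomes a loop at `r`. -/
noncomputable def endsD : E → Sym2 V := fun e => if AtD ends D e then s(r, r) else ends e

variable {ends D r}

/-- `endsD` on an edge at `D`. -/
lemma endsD_of_atD {e : E} (h : AtD ends D e) : endsD ends D r e = s(r, r) := by
  simp [endsD, h]

/-- `endsD` on an edge not at `D`. -/
lemma endsD_of_not_atD {e : E} (h : ¬ AtD ends D e) : endsD ends D r e = ends e := by
  simp [endsD, h]

/-- An edge with ends `{u, v}` is not at `D` when `u, v ∉ D`. -/
lemma not_atD_of_ends {e : E} {u v : V} (hends : ends e = s(u, v)) (hu : u ∉ D) (hv : v ∉ D) :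
    ¬ AtD ends D e := by
  rintro ⟨d, hd, hde⟩
  rw [hends, Sym2.mem_iff] at hde
  rcases hde with rfl | rfl
  · exact hu hd
  · exact hv hd

/-- Adjacency in the open subgraph of `G − D`: an open edge of `G` between two distinct
vertices outside `D`. -/
lemma openGraph_endsD_adj {ω : Config E} {u v : V} :
    (openGraph (endsD ends D r) ω).Adj u v ↔ u ≠ v ∧ u ∉ D ∧ v ∉ D ∧ OpenAdj ends ω u v := by
  rw [openGraph_adj]
  constructor
  · rintro ⟨huv, e, he, hends⟩
    by_cases hd : AtD ends D e
    · rw [endsD_of_atD hd, Sym2.eq_iff] at hends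
      exfalso
      rcases hends with ⟨h1, h2⟩ | ⟨h1, h2⟩
      · exact huv (h1.symm.trans h2)
      · exact huv (h2.symm.trans h1)
    · rw [endsD_of_not_atD hd] at hends
      refine ⟨huv, ?_, ?_, e, he, hends⟩
      · intro hu
        exact hd ⟨u, hu, by rw [hends]; exact Sym2.mem_mk_left _ _⟩
      · intro hv
        exact hd ⟨v, hv, by rw [hends]; exact Sym2.mem_mk_right _ _⟩
  · rintro ⟨huv, hud, hvd, e, he, hends⟩
    refine ⟨huv, e, he, ?_⟩
    rw [endsD_of_not_atD (not_atD_of_ends hends hud hvd), hends]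

/-- Connections in `G − D` are connections in `G`. -/
lemma conn_of_conn_endsD {ω : Config E} {u v : V} (h : Conn (endsD ends D r) ω u v) :
    Conn ends ω u v := by
  refine mem_of_conn_of_closed (S := {w | Conn ends ω u w}) ?_ (conn_refl _ _ _) h
  intro x hx y hxy
  obtain ⟨_, _, _, hadj⟩ := openGraph_endsD_adj.1 hxy
  exact conn_trans hx (conn_of_openAdj hadj)

/-- A vertex of `D` is isolated in `G − D`. -/
lemma eq_of_conn_endsD_of_mem {ω : Config E} {d x : V} (hd : d ∈ D)
    (h : Conn (endsD ends D r) ω d x) : x = d := by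
  have key : x ∈ {w | w = d} := by
    refine mem_of_conn_of_closed (S := {w | w = d}) ?_ rfl h
    intro a ha b hab
    obtain ⟨_, had, _, _⟩ := openGraph_endsD_adj.1 hab
    exact (had (ha ▸ hd)).elim
  exact key

/-- A vertex of `D` lies in no `Y`-world of `{r, s}` in `G − D`. -/
lemma not_mem_K2_endsD {s d : V} (hd : d ∈ D) (hr : d ≠ r) (hs : d ≠ s) (ω : Config E) :
    d ∉ K2 (endsD ends D r) r s ω := by
  intro h
  rcases mem_K2_iff.1 h with hc | hc
  · exact hr (eq_of_conn_endsD_of_mem hd (conn_symm hc)).symm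
  · exact hs (eq_of_conn_endsD_of_mem hd (conn_symm hc)).symm

/-- A vertex of `D` lies in no `W`-world of `{r, s}` in `G − D`. -/
lemma not_mem_M2_endsD {s d : V} (hd : d ∈ D) (hr : d ≠ r) (hs : d ≠ s) (ω : Config E) :
    d ∉ M2 (endsD ends D r) r s ω :=
  not_mem_K2_endsD hd hr hs (OneColourSwitch.compl ω)

/-- Connectivity in `G − D` only sees the edges not at `D`. -/
lemma conn_endsD_of_eqOn {ω ω' : Config E} (h : ∀ e, ¬ AtD ends D e → ω e = ω' e) {u v : V}
    (hc : Conn (endsD ends D r) ω u v) : Conn (endsD ends D r) ω' u v := by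
  refine mem_of_conn_of_closed (S := {w | Conn (endsD ends D r) ω' u w}) ?_ (conn_refl _ _ _) hc
  intro x hx y hxy
  obtain ⟨_, hxd, hyd, e, he, hends⟩ := openGraph_endsD_adj.1 hxy
  have hd : ¬ AtD ends D e := not_atD_of_ends hends hxd hyd
  refine conn_trans hx (conn_of_openAdj ⟨e, ?_, ?_⟩)
  · rw [← h e hd]; exact he
  · rw [endsD_of_not_atD hd]; exact hends

/-- Connectivity in `G − D` only sees the edges not at `D` (both directions). -/
lemma conn_endsD_iff_of_eqOn {ω ω' : Config E} (h : ∀ e, ¬ AtD ends D e → ω e = ω' e) {u v : V} :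
    Conn (endsD ends D r) ω u v ↔ Conn (endsD ends D r) ω' u v :=
  ⟨conn_endsD_of_eqOn h, conn_endsD_of_eqOn (fun e he => (h e he).symm)⟩

/-- The `Y`-world of `{r, s}` in `G − D` only sees the edges not at `D`. -/
lemma K2_endsD_eq_of_eqOn {ω ω' : Config E} (h : ∀ e, ¬ AtD ends D e → ω e = ω' e) (s : V) :
    K2 (endsD ends D r) r s ω = K2 (endsD ends D r) r s ω' := by
  ext x
  simp only [mem_K2_iff, conn_endsD_iff_of_eqOn h]

/-- The `W`-world of `{r, s}` in `G − D` only sees the edges not at `D`. -/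
lemma M2_endsD_eq_of_eqOn {ω ω' : Config E} (h : ∀ e, ¬ AtD ends D e → ω e = ω' e) (s : V) :
    M2 (endsD ends D r) r s ω = M2 (endsD ends D r) r s ω' := by
  rw [← K2_compl, ← K2_compl]
  exact K2_endsD_eq_of_eqOn (fun e he => by simp [OneColourSwitch.compl, h e he]) s

/-- The sided set of `G − D` only sees the edges not at `D`. -/
lemma A0_endsD_eq_of_eqOn [Fintype V] [DecidableEq V] {ω ω' : Config E}
    (h : ∀ e, ¬ AtD ends D e → ω e = ω' e) (s : V) :
    A0 (endsD ends D r) r s ω = A0 (endsD ends D r) r s ω' := by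
  ext y
  simp only [mem_A0]
  rw [K2_endsD_eq_of_eqOn h, M2_endsD_eq_of_eqOn h]

end LoopedGraph

section Objects

variable [Fintype V] [DecidableEq V] [Fintype E] [DecidableEq E]

variable (ends : E → Sym2 V)

/-- The `T`-edges at `d`: the edges between `d` and `r` or `s`. -/
noncomputable def TsetAt (d r s : V) : Finset E :=
  univ.filter (fun e => ends e = s(d, r) ∨ ends e = s(d, s))

/-- The `T`-edges: the edges between `D` and `{r, s}`. -/
noncomputable def Tset (D : Finset V) (r s : V) : Finset E :=
  univ.filter (fun e => ∃ d ∈ D, ends e = s(d, r) ∨ ends e = s(d, s))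

/-- The coordinate assignment: the blocks of `x.1` on the `W`-side (every edge touching them
flipped, the edges to `D` included) and the `T`-edges of `x.2` coloured `W`. -/
noncomputable def assignX (x : Finset (Finset V) × Finset E) (ρ : Config E) : Config E :=
  flipTouch ends (↑(unionT x.1) : Set V) (flipF x.2 ρ)

/-- The blocks: the components of the sided set of `{r, s}` in `G − D`. -/
noncomputable def blocks (D : Finset V) (r s : V) (ρ : Config E) : Finset (Finset V) :=
  comps (endsD ends D r) r s ρ

/-- `d` has a `Y`-source in the assignment `x`: a `T`-edge at `d` left `Y`, or an `A`-side block
with a `Y` edge to `d`. -/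
def srcY (D : Finset V) (d r s : V) (ρ : Config E) (x : Finset (Finset V) × Finset E) : Prop :=
  (∃ e ∈ TsetAt ends d r s, e ∉ x.2) ∨ ∃ C ∈ blocks ends D r s ρ, C ∉ x.1 ∧ hasY ends d ρ C

/-- `d` has a `W`-source in the assignment `x`: a `T`-edge at `d` coloured `W`, or a `B`-side
block whose `Y` edge to `d` was flipped. -/
def srcW (d r s : V) (ρ : Config E) (x : Finset (Finset V) × Finset E) : Prop :=
  (∃ e ∈ x.2, e ∈ TsetAt ends d r s) ∨ ∃ C ∈ x.1, hasY ends d ρ C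

/-- The legal coordinate vectors: for every `d ∈ D`, a `W`-sourced `d` has no dead edge to an
`A`-side block and a `Y`-sourced `d` none to a `B`-side block. -/
noncomputable def L4 (D : Finset V) (r s : V) (ρ : Config E) :
    Finset (Finset (Finset V) × Finset E) :=
  ((blocks ends D r s ρ).powerset ×ˢ (Tset ends D r s).powerset).filter (fun x => ∀ d ∈ D,
    (srcW ends d r s ρ x → ∀ C ∈ blocks ends D r s ρ, C ∉ x.1 → ¬ hasW ends d ρ C) ∧
    (srcY ends D d r s ρ x → ∀ C ∈ x.1, ¬ hasW ends d ρ C))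

/-- The representatives: `Sep` in `G − D`, every block on the `Y`-side, every `T`-edge `Y`. -/
noncomputable def RepD (p q r s : V) (D : Finset V) : Finset (Config E) :=
  univ.filter (fun ρ => sep2 (endsD ends D r) p q r s ρ ∧
    (∀ y ∈ M2 (endsD ends D r) r s ρ, y = r ∨ y = s) ∧ ∀ e ∈ Tset ends D r s, ρ e = true)

/-- No vertex outside `{r, s} ∪ D` lies in both worlds of `{r, s}`. -/
def DSub (r s : V) (D : Finset V) (ω : Config E) : Prop :=
  ∀ x, x ≠ r → x ≠ s → x ∉ D → x ∈ K2 ends r s ω → x ∉ M2 ends r s ω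

/-- The colourings of the restricted sum: `Sep` and doubly reached only inside `D`. -/
noncomputable def DSubSet (p q r s : V) (D : Finset V) : Finset (Config E) :=
  univ.filter (fun ω => sep2 ends p q r s ω ∧ DSub ends r s D ω)

/-- The `m9` sign sum over the `Sep`-colourings doubly reached only inside `D`:
`Σ_{ω ∈ Sep, D(ω) ⊆ D} σ_pq · σ_rs`. -/
noncomputable def dSignSum (p q r s : V) (D : Finset V) : ℤ :=
  ∑ ω : Config E, if sep2 ends p q r s ω ∧ DSub ends r s D ω then
    sigma ends ω p q * sigma ends ω r s else 0

/-- The no-pocket hypothesis: every neighbour of a vertex of `D` outside `{r, s} ∪ D` is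
adjacent to `r` or to `s`. -/
def NoPocketAt (D : Finset V) (r s : V) : Prop :=
  ∀ d ∈ D, ∀ e x, ends e = s(d, x) → x ∉ D → x ≠ r → x ≠ s →
    ∃ e', ends e' = s(x, r) ∨ ends e' = s(x, s)

/-- No edge joins two different vertices of `D`. -/
def DIndep (D : Finset V) : Prop :=
  ∀ e d₁ d₂, d₁ ∈ D → d₂ ∈ D → ends e = s(d₁, d₂) → d₁ = d₂

variable {ends}

omit [Fintype V] [DecidableEq E] in
/-- Membership in `TsetAt`. -/
lemma mem_TsetAt {d r s : V} {e : E} :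
    e ∈ TsetAt ends d r s ↔ ends e = s(d, r) ∨ ends e = s(d, s) := by
  simp [TsetAt]

omit [Fintype V] [DecidableEq E] in
/-- Membership in `Tset`. -/
lemma mem_Tset {D : Finset V} {r s : V} {e : E} :
    e ∈ Tset ends D r s ↔ ∃ d ∈ D, ends e = s(d, r) ∨ ends e = s(d, s) := by
  simp [Tset]

omit [Fintype V] [DecidableEq E] in
/-- A `T`-edge at `d ∈ D` is a `T`-edge. -/
lemma TsetAt_subset_Tset {D : Finset V} {d r s : V} (hd : d ∈ D) :
    TsetAt ends d r s ⊆ Tset ends D r s := by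
  intro e he
  exact mem_Tset.2 ⟨d, hd, mem_TsetAt.1 he⟩

omit [Fintype V] [DecidableEq E] in
/-- A `T`-edge is at `D`. -/
lemma atD_of_mem_Tset {D : Finset V} {r s : V} {e : E} (h : e ∈ Tset ends D r s) :
    AtD ends D e := by
  obtain ⟨d, hd, h'⟩ := mem_Tset.1 h
  refine ⟨d, hd, ?_⟩
  rcases h' with h' | h' <;> rw [h'] <;> exact Sym2.mem_mk_left _ _

omit [Fintype V] in
/-- A `T`-edge at `r` or `s`: the value of `flipF` of a set of `T`-edges on an edge not at `D`. -/
lemma flipF_Tset_of_not_atD {D : Finset V} {r s : V} {F : Finset E} (hF : F ⊆ Tset ends D r s)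
    {ρ : Config E} {e : E} (he : ¬ AtD ends D e) : flipF F ρ e = ρ e := by
  apply flipF_of_notMem
  intro h
  exact he (atD_of_mem_Tset (hF h))

/-- Membership in the representatives. -/
lemma mem_RepD {p q r s : V} {D : Finset V} {ρ : Config E} :
    ρ ∈ RepD ends p q r s D ↔ sep2 (endsD ends D r) p q r s ρ ∧
      (∀ y ∈ M2 (endsD ends D r) r s ρ, y = r ∨ y = s) ∧ ∀ e ∈ Tset ends D r s, ρ e = true := by
  simp [RepD]

omit [Fintype V] [DecidableEq V] in
/-- Membership in `DSubSet`. -/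
lemma mem_DSubSet {p q r s : V} {D : Finset V} {ω : Config E} :
    ω ∈ DSubSet ends p q r s D ↔ sep2 ends p q r s ω ∧ DSub ends r s D ω := by
  simp [DSubSet]

omit [DecidableEq E] in
/-- Membership in `L4`. -/
lemma mem_L4 {D : Finset V} {r s : V} {ρ : Config E} {x : Finset (Finset V) × Finset E} :
    x ∈ L4 ends D r s ρ ↔ (x.1 ⊆ blocks ends D r s ρ ∧ x.2 ⊆ Tset ends D r s) ∧ ∀ d ∈ D,
      (srcW ends d r s ρ x → ∀ C ∈ blocks ends D r s ρ, C ∉ x.1 → ¬ hasW ends d ρ C) ∧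
      (srcY ends D d r s ρ x → ∀ C ∈ x.1, ¬ hasW ends d ρ C) := by
  simp only [L4, Finset.mem_filter, Finset.mem_product, Finset.mem_powerset]

/-- The representative of a colouring: every `B`-side block of `G − D` switched to the `A`-side
(all edges touching it, the edges to `D` included) and every `T`-edge coloured `Y`. -/
noncomputable def repOf (D : Finset V) (r s : V) (ω : Config E) : Config E :=
  flipTouch ends (↑(Bside (endsD ends D r) r s ω) : Set V)
    (flipF ((Tset ends D r s).filter (fun e => ω e = false)) ω)

/-- The coordinates of a colouring: its `B`-side blocks and its `W`-coloured `T`-edges. -/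
noncomputable def coordsOf (D : Finset V) (r s : V) (ω : Config E) :
    Finset (Finset V) × Finset E :=
  ((blocks ends D r s ω).filter (fun C => C ⊆ Bside (endsD ends D r) r s ω),
    (Tset ends D r s).filter (fun e => ω e = false))

end Objects

end NoPocketSet

end Summit.Ventures.PercRepro2
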